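import Literature.AlgebraicGeometry.Resolution.AffineBlowupCartier
import Literature.AlgebraicGeometry.Resolution.AffineBlowupAlgebra
import Literature.AlgebraicGeometry.Resolution.IntegralClosureEssFiniteType
import HarnessLib

/-!
# The normalisation of an affine domain is a one-chart blowing up

Topic: `Literature/AlgebraicGeometry/Resolution`. Let `R` be a domain with fraction field `K` and
integral closure `Ã ⊆ K`, and let `c ∈ R`, `c ≠ 0`, be a **universal denominator** of `Ã`
(`c Ã ⊆ R`; such `c` exists exactly when `Ã` is a finite `R`-module, e.g. for `R` of finite type
over a field — E. Noether, tree `module_finite_integralClosure_of_essFiniteType`). For the ideal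
`I = c Ã = {x ∈ R | x / c ∈ Ã}` of `R`:

* `basicOpen_reesT_eq_top_of_sq` — for ANY ideal `I` and `g ∈ I` with `x² ∈ g I` for all `x ∈ I`,
  the chart `D₊(gt)` of `Bl_I(Spec R) = Proj R[It]` is everything (`(xt)² = (gt)(yt)`), and then
  `isIso_chartι_of_basicOpen_eq_top`: the chart `Spec (R[It])_{(gt)} → Bl_I(Spec R)` is an
  isomorphism;
* `sq_mem_of_mem_conductorMultiple` — `I = c Ã` has this property at `g = c`
  (`(c x̃)² = c · (c x̃²)`);
* `nonempty_algEquiv_away_integralClosure` — the chart ring `(R[It])_{(ct)} ≅ R[I/c] = R[Ã] = Ã`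
  as `R`-algebras;
* `exists_iso_affineBlowup_Spec_integralClosure` — **`Bl_{cÃ}(Spec R) ≅ Spec Ã` over `Spec R`**:
  the normalisation `Spec Ã → Spec R` IS the blowing up of `Spec R` along `c Ã`;
* `exists_universalDenominator_of_finite` — a finite `Ã` has a universal denominator `c ≠ 0`;
  `exists_ideal_affineBlowup_iso_normalization` — **for a domain of finite type over a field, the
  normalisation is the blowing up of a non-zero ideal** (E. Noether's finiteness, tree
  `module_finite_integralClosure_of_essFiniteType`, + the above).

This is the explicit affine instance of "a finite birational (projective) morphism onto an integral
scheme is a blowing up" (Liu 2002, Prop. 8.1.24 for projective birational morphisms; here no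
Noetherian or quasi-projectivity hypothesis is needed and the centre is named). Everything is
proved; no definitions (the ideal `c Ã` enters through its membership characterisation `hI`), no
named facts.

## Sources

* Q. Liu, *Algebraic Geometry and Arithmetic Curves* (2002), Prop. 8.1.24 (projective birational
  morphisms are blowing ups) and §8.1.3. [Liu2002]
* The Stacks Project, Tag 0804 (charts `D₊(at) = Spec R[I/a]` of `Proj R[It]`). [StacksProject]
-/

noncomputable section

open AlgebraicGeometry CategoryTheory Polynomial HomogeneousLocalization

namespace Literature.AlgebraicGeometry.Resolution

universe u

section OneChart

variable {R : Type u} [CommRing R] {I : Ideal R}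

/-- **One chart suffices.** If every `x ∈ I` satisfies `x · x = g · y` for some `y ∈ I`, then the
chart `D₊(gt)` of `Bl_I(Spec R) = Proj R[It]` is the whole blowing up: `(xt)² = (gt)(yt)`, so
`D₊(xt) = D₊((xt)²) ⊆ D₊(gt)`, and the `D₊(xt)`, `x ∈ I`, cover (Stacks 0804). [folklore] -/
theorem basicOpen_reesT_eq_top_of_sq (g : R) (hg : g ∈ I)
    (h : ∀ x ∈ I, ∃ y ∈ I, x * x = g * y) :
    Proj.basicOpen (reesGrading I) (reesT g hg) = ⊤ := by
  refine top_le_iff.mp ?_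
  rw [← affineBlowup.iSup_basicOpen_reesT_eq_top I]
  refine iSup_le fun b => ?_
  obtain ⟨y, hy, hby⟩ := h b.1 b.2
  have hsq : reesT (I := I) b.1 b.2 ^ 2 = reesT g hg * reesT y hy := by
    apply Subtype.ext
    change (reesT (I := I) b.1 b.2 : R[X]) ^ 2 = (reesT g hg : R[X]) * (reesT y hy : R[X])
    rw [coe_reesT, coe_reesT, coe_reesT, monomial_pow, monomial_mul_monomial, sq, hby]
  calc Proj.basicOpen (reesGrading I) (reesT b.1 b.2)
      = Proj.basicOpen (reesGrading I) (reesT b.1 b.2 ^ 2) :=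
        (Proj.basicOpen_pow (reesGrading I) _ 2 two_pos).symm
    _ ≤ Proj.basicOpen (reesGrading I) (reesT g hg) :=
        Proj.basicOpen_mono (reesGrading I) _ _ ⟨reesT y hy, hsq⟩

/-- If `D₊(gt)` is the whole blowing up then the chart `Spec (R[It])_{(gt)} → Bl_I(Spec R)` is an
isomorphism (an open immersion onto everything). [folklore] -/
theorem isIso_chartι_of_basicOpen_eq_top (g : R) (hg : g ∈ I)
    (h : Proj.basicOpen (reesGrading I) (reesT g hg) = ⊤) :
    IsIso (affineBlowup.chartι (I := I) g hg) :=
  isIso_of_isOpenImmersion_of_opensRange_eq_top _ (by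
    rw [← Scheme.Hom.image_top_eq_opensRange, affineBlowup.image_top_chartι, h])

end OneChart

section Normalization

variable {R : Type u} [CommRing R] [IsDomain R] (K : Type u) [Field K] [Algebra R K]
  [IsFractionRing R K]

omit [IsDomain R] in
/-- For `I = c Ã = {x | x / c ∈ Ã}`: every `x = c x̃ ∈ I` has `x² = c · (c x̃²)` with `c x̃² ∈ I`.
[folklore] -/
theorem sq_mem_of_mem_conductorMultiple (c : R) {I : Ideal R}
    (hI : ∀ x : R, x ∈ I ↔ ∃ y ∈ integralClosure R K, algebraMap R K c * y = algebraMap R K x)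
    (hc : ∀ y : K, y ∈ integralClosure R K → ∃ a : R, algebraMap R K a = algebraMap R K c * y) :
    ∀ x ∈ I, ∃ y ∈ I, x * x = c * y := by
  have hinj : Function.Injective (algebraMap R K) := IsFractionRing.injective R K
  intro x hx
  obtain ⟨x', hx', hxx'⟩ := (hI x).mp hx
  obtain ⟨a, ha⟩ := hc (x' * x') ((integralClosure R K).mul_mem hx' hx')
  refine ⟨a, (hI _).mpr ⟨x' * x', (integralClosure R K).mul_mem hx' hx', ha.symm⟩, hinj ?_⟩
  rw [map_mul, map_mul, ha, ← hxx']
  ring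

/-- **The chart ring of `D₊(ct)` is the normalisation**: for `I = c Ã` with `c ≠ 0` a universal
denominator of `Ã`, `(R[It])_{(ct)} ≅ R[I/c] = R[Ã] = Ã` as `R`-algebras (the chart ring maps
isomorphically onto the affine blowup algebra `R[I/c] ⊆ R[1/c]`, Stacks 07Z3, which embeds into
`K` with image generated by the `x / c`, `x ∈ I`, i.e. by `Ã`). [folklore] -/
theorem nonempty_algEquiv_away_integralClosure (c : R) (hc0 : c ≠ 0) {I : Ideal R} (hcI : c ∈ I)
    (hI : ∀ x : R, x ∈ I ↔ ∃ y ∈ integralClosure R K, algebraMap R K c * y = algebraMap R K x)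
    (hc : ∀ y : K, y ∈ integralClosure R K → ∃ a : R, algebraMap R K a = algebraMap R K c * y) :
    letI := (reesChartBase (I := I) c hcI).toAlgebra
    Nonempty (Away (reesGrading I) (reesT c hcI) ≃ₐ[R] integralClosure R K) := by
  letI := (reesChartBase (I := I) c hcI).toAlgebra
  have hinj : Function.Injective (algebraMap R K) := IsFractionRing.injective R K
  have hc0K : algebraMap R K c ≠ 0 := fun h => hc0 (hinj (by rw [h, map_zero]))
  -- `R[1/c] → K`
  have hunit : ∀ y : Submonoid.powers c, IsUnit (Algebra.ofId R K y) := by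
    rintro ⟨y, n, rfl⟩
    exact isUnit_iff_ne_zero.mpr (by
      rw [Algebra.ofId_apply, map_pow]
      exact pow_ne_zero _ hc0K)
  let ψ : Localization.Away c →ₐ[R] K :=
    IsLocalization.liftAlgHom (M := Submonoid.powers c) (f := Algebra.ofId R K) hunit
  have hψinj : Function.Injective ψ := by
    rw [IsLocalization.coe_liftAlgHom, IsLocalization.lift_injective_iff]
    intro x y
    constructor
    · intro h
      exact congrArg _ (IsLocalization.injective (Localization.Away c)
        (powers_le_nonZeroDivisors_of_noZeroDivisors hc0) h)
    · intro h
      exact congrArg _ (hinj h)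
  have hψc : ψ (IsLocalization.Away.invSelf c) = (algebraMap R K c)⁻¹ := by
    have h1 : ψ (algebraMap R (Localization.Away c) c) *
        ψ (IsLocalization.Away.invSelf c) = 1 := by
      rw [← map_mul, IsLocalization.Away.mul_invSelf, map_one]
    rw [AlgHom.commutes] at h1
    exact eq_inv_of_mul_eq_one_right h1
  -- the image of the generators `x / c`, `x ∈ I`, is `Ã`
  have himage : ψ '' blowupAlgebraGens I c = (integralClosure R K : Set K) := by
    ext z
    constructor
    · rintro ⟨_, ⟨x, hx, rfl⟩, rfl⟩
      obtain ⟨y, hy, hxy⟩ := (hI x).mp hx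
      rw [SetLike.mem_coe, map_mul ψ, AlgHom.commutes, hψc, ← hxy, mul_comm, ← mul_assoc,
        inv_mul_cancel₀ hc0K, one_mul]
      exact hy
    · intro hz
      obtain ⟨a, ha⟩ := hc z hz
      have haI : a ∈ I := (hI _).mpr ⟨z, hz, ha.symm⟩
      refine ⟨_, ⟨a, haI, rfl⟩, ?_⟩
      rw [map_mul ψ, AlgHom.commutes, hψc, ha, mul_comm (algebraMap R K c) z,
        mul_inv_cancel_right₀ hc0K]
  have heq : (blowupAlgebra I c).map ψ = integralClosure R K := by
    rw [blowupAlgebra, AlgHom.map_adjoin, himage, Algebra.adjoin_eq]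
  let e₂ : blowupAlgebra I c ≃ₐ[R] integralClosure R K :=
    ((blowupAlgebra I c).equivMapOfInjective ψ hψinj).trans (Subalgebra.equivOfEq _ _ heq)
  let e : Away (reesGrading I) (reesT c hcI) ≃+* integralClosure R K :=
    (reesChartEquiv c hcI).trans e₂.toRingEquiv
  have hcomm : ∀ x : R, e (reesChartBase (I := I) c hcI x) = algebraMap R (integralClosure R K) x := by
    intro x
    change e₂ (reesChartEquiv c hcI (reesChartBase c hcI x)) = _
    rw [reesChartEquiv_reesChartBase, AlgEquiv.commutes]
  exact ⟨AlgEquiv.ofRingEquiv (f := e) (fun x => hcomm x)⟩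

/-- **The normalisation is the blowing up along `c Ã`** (affine, explicit form of Liu 2002,
Prop. 8.1.24 for the finite birational morphism `Spec Ã → Spec R`): for a domain `R` with fraction
field `K`, integral closure `Ã`, and a universal denominator `c ≠ 0` of `Ã`, the blowing up of
`Spec R` along `I = c Ã = {x | x/c ∈ Ã}` is isomorphic to `Spec Ã` over `Spec R`.
[cite: Liu2002, Prop. 8.1.24 and §8.1.3] -/
theorem exists_iso_affineBlowup_Spec_integralClosure (c : R) (hc0 : c ≠ 0) {I : Ideal R}
    (hI : ∀ x : R, x ∈ I ↔ ∃ y ∈ integralClosure R K, algebraMap R K c * y = algebraMap R K x)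
    (hc : ∀ y : K, y ∈ integralClosure R K → ∃ a : R, algebraMap R K a = algebraMap R K c * y) :
    ∃ e : affineBlowup I ≅ Spec (.of (integralClosure R K)),
      e.hom ≫ Spec.map (CommRingCat.ofHom (algebraMap R (integralClosure R K))) =
        affineBlowup.π I := by
  have hcI : c ∈ I := (hI c).mpr ⟨1, (integralClosure R K).one_mem, by rw [mul_one]⟩
  letI := (reesChartBase (I := I) c hcI).toAlgebra
  obtain ⟨eA⟩ := nonempty_algEquiv_away_integralClosure K c hc0 hcI hI hc
  haveI := isIso_chartι_of_basicOpen_eq_top c hcI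
    (basicOpen_reesT_eq_top_of_sq c hcI (sq_mem_of_mem_conductorMultiple K c hI hc))
  -- `Spec Ã ≅ Spec (R[It])_{(ct)} ≅ Bl_I(Spec R)`
  let e₁ : Spec (.of (integralClosure R K)) ≅ Spec (.of (Away (reesGrading I) (reesT c hcI))) :=
    Scheme.Spec.mapIso eA.toRingEquiv.toCommRingCatIso.op
  let e₂ : Spec (.of (Away (reesGrading I) (reesT c hcI))) ≅ affineBlowup I :=
    asIso (affineBlowup.chartι (I := I) c hcI)
  have h1 : e₁.inv = Spec.map (CommRingCat.ofHom (eA.symm.toRingEquiv.toRingHom)) := rfl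
  have h2 : e₂.inv = inv (affineBlowup.chartι (I := I) c hcI) := rfl
  refine ⟨(e₁ ≪≫ e₂).symm, ?_⟩
  rw [Iso.symm_hom, Iso.trans_inv, Category.assoc, h2, IsIso.inv_comp_eq,
    affineBlowup.chartι_π, h1, ← Spec.map_comp]
  congr 1
  apply CommRingCat.hom_ext
  apply RingHom.ext
  intro x
  change eA.symm (algebraMap R (integralClosure R K) x) = reesChartBase c hcI x
  exact eA.symm.commutes x


/-- A finite integral closure has a **universal denominator**: `c ≠ 0` in `R` with `c Ã ⊆ R`
(clear the denominators of finitely many module generators). [folklore] -/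
theorem exists_universalDenominator_of_finite
    (hfin : Module.Finite R (integralClosure R K)) :
    ∃ c : R, c ≠ 0 ∧
      ∀ y : K, y ∈ integralClosure R K → ∃ a : R, algebraMap R K a = algebraMap R K c * y := by
  classical
  obtain ⟨s, hs⟩ := Module.finite_def.mp hfin
  obtain ⟨⟨c, hcmem⟩, hcint⟩ :=
    IsLocalization.exist_integer_multiples (nonZeroDivisors R) s
      (fun x : integralClosure R K => (x : K))
  refine ⟨c, nonZeroDivisors.ne_zero hcmem, fun x hx => ?_⟩
  have hx' : (⟨x, hx⟩ : integralClosure R K) ∈ Submodule.span R (s : Set (integralClosure R K)) := by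
    rw [hs]; trivial
  refine Submodule.span_induction
    (p := fun (y : integralClosure R K) _ => ∃ a : R, algebraMap R K a = algebraMap R K c * (y : K))
    ?_ ?_ ?_ ?_ hx'
  · intro y hy
    obtain ⟨a, ha⟩ := hcint y hy
    exact ⟨a, by rw [ha, Algebra.smul_def]⟩
  · exact ⟨0, by simp⟩
  · rintro y z - - ⟨a₁, ha₁⟩ ⟨a₂, ha₂⟩
    exact ⟨a₁ + a₂, by rw [map_add, ha₁, ha₂, Subalgebra.coe_add, mul_add]⟩
  · rintro r y - ⟨a, ha⟩
    refine ⟨r * a, ?_⟩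
    rw [map_mul, ha, Subalgebra.coe_smul, Algebra.smul_def]
    ring

/-- **The normalisation of an affine variety is a blowing up**: for a domain `A` of finite type
over a field `k` there is an ideal `I ≠ 0` of `A` with `Bl_I(Spec A) ≅ Spec Ã` over `Spec A`,
`Ã` the integral closure of `A` in its fraction field (`I = c Ã` for a universal denominator `c`
of the finite `A`-module `Ã`). [cite: Liu2002, Prop. 8.1.24 and Prop. 4.1.27] -/
theorem exists_ideal_affineBlowup_iso_normalization (k : Type u) [Field k] (A : Type u)
    [CommRing A] [IsDomain A] [Algebra k A] [Algebra.FiniteType k A] :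
    ∃ I : Ideal A, I ≠ ⊥ ∧
      ∃ e : affineBlowup I ≅ Spec (.of (integralClosure A (FractionRing A))),
        e.hom ≫ Spec.map (CommRingCat.ofHom (algebraMap A (integralClosure A (FractionRing A)))) =
          affineBlowup.π I := by
  haveI : Algebra.EssFiniteType k A := Algebra.EssFiniteType.of_finiteType k A
  obtain ⟨c, hc0, hc⟩ := exists_universalDenominator_of_finite (FractionRing A)
    (module_finite_integralClosure_of_essFiniteType k A (FractionRing A))
  let I : Ideal A :=
    ((Subalgebra.toSubmodule (integralClosure A (FractionRing A))).map
      (LinearMap.mulLeft A (algebraMap A (FractionRing A) c))).comap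
      (Algebra.linearMap A (FractionRing A))
  have hI : ∀ x : A, x ∈ I ↔ ∃ y ∈ integralClosure A (FractionRing A),
      algebraMap A (FractionRing A) c * y = algebraMap A (FractionRing A) x := by
    intro x
    simp only [I, Submodule.mem_comap, Algebra.linearMap_apply, Submodule.mem_map,
      Subalgebra.mem_toSubmodule, LinearMap.mulLeft_apply]
  have hcI : c ∈ I := (hI c).mpr ⟨1, Subalgebra.one_mem _, by rw [mul_one]⟩
  refine ⟨I, fun h => hc0 (by rw [h, Ideal.mem_bot] at hcI; exact hcI), ?_⟩
  exact exists_iso_affineBlowup_Spec_integralClosure (FractionRing A) c hc0 hI hc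

end Normalization

end Literature.AlgebraicGeometry.Resolution

end
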